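import Summits.Ventures.LatticeQCDFlow.Scaling.UrnDeletionCoupling

/-!
HONEST FRAMING: exact (Metropolis-corrected) sampling algorithms for lattice gauge theory; figures
of merit are autocorrelation/cost numbers at stated couplings and volumes; no continuum-physics
claim.

# HubChainDetailedBalance — INSIDE A REFRESH CYCLE THE HUB CONTENT OF THE LUMPED STAR IS A REVERSIBLE CHAIN WITH STATIONARY LAW `∝ N(v)/W(v)`:
# THE URN LAW OF FILE 3 IS THE EQUILIBRIUM OF THE SWAP PHASE (lean-2 GEN-35, ours)

Venture-side (OURS).  Cell `lqcd-flow` (pub-lqcd), unit `pub-lqcd-lean-2-g35`, 2026-08-29.  Chapter V (composition variables), file 8.  One copy of the homogeneous `q`-content star,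
lumped by exchangeability of the levels: inside a refresh cycle the full composition `N` (hub included, `Σ N = K + 1`) is fixed and only the hub content `h` moves; a swap
attempt picks a level, i.e. a content `v` with probability `(N(v) − 𝟙{v = h})/K`, and exchanges it with the hub content with the Metropolis probability
`acc(h,v) = min{1, W(h)/W(v)}` (`W = μ_1/μ_0`).  So the hub chain is `K_N(h,v) = ((N(v) − 𝟙{v=h})/K)·acc(h,v)` for `v ≠ h` (diagonal = the rest).  This file: `K_N` is in
detailed balance with `m(v) = N(v)/W(v)` — `m(h)K_N(h,v) = m(v)K_N(v,h)`, both sides being `(N(h)N(v)/K)·min{1/W(h), 1/W(v)}` — hence `m` (normalised: the urn law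
`u(v) = (N(v)/W(v))/Z` of file 3) is stationary for the swap phase; the urn of files 3, 6, 7 is the refresh cycle whose swap phase has reached equilibrium (`τ = ∞`).
Hypothesis-equations (`hacc`, `hKoff`, `hKdiag`), no definitions, no chain theory beyond finite sums.

## What is proved

* `hub_acc_mul_inv` (`acc(h,v)/W(h) = min{1/W(h), 1/W(v)}`), **`hubChain_detailedBalance`** (`m(h)K_N(h,v) = m(v)K_N(v,h)`),
  `hubChain_offDiag_nonneg`, `hubChain_offDiag_sum_le` (`Σ_{v≠h} K_N(h,v) ≤ 1` when `N(h) ≥ 1`, `Σ N = K+1`), **`hubChain_stationary`** (`Σ_h m(h)K_N(h,v) = m(v)` for the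
  kernel completed by its diagonal), `hubChain_urnLaw_stationary` (the same for `u = m/Z`).

Reading (no numerics implied): justifies the urn deletion law as the `τ → ∞` end-hub law of the star (convergence of the `σ`-resolvent `(1−σ)Σ σⁿK_Nⁿ` to the stationary
law as `σ → 1` is standard and NOT typed here).  Literature grade (cell rule): OWN, elementary; nothing cited as a fact; no new bib keys.
-/

open Finset

namespace Summit.Ventures.LatticeQCDFlow.Scaling

section HubChain
variable {S : Type*} [Fintype S] [DecidableEq S] {W : S → ℝ} {acc Kh : S → S → ℝ} {N : S → ℕ} {K : ℕ} {m : S → ℝ}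

omit [Fintype S] [DecidableEq S] in
/-- `acc(h,v)/W(h) = min{1/W(h), 1/W(v)}`. [ours] -/
theorem hub_acc_mul_inv (hW : ∀ v, 0 < W v) (hacc : ∀ h v, acc h v = min 1 (W h / W v)) (h v : S) :
    acc h v / W h = min (1 / W h) (1 / W v) := by
  rw [hacc]
  have hWh := hW h; have hWv := hW v
  rcases le_total (W h) (W v) with hle | hle
  · rw [min_eq_right ((div_le_one hWv).mpr hle), min_eq_right (one_div_le_one_div_of_le hWh hle)]
    field_simp
  · rw [min_eq_left ((one_le_div hWv).mpr hle), min_eq_left (one_div_le_one_div_of_le hWv hle)]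

omit [Fintype S] in
/-- **DETAILED BALANCE:** with `m(v) = N(v)/W(v)` and `K_N(h,v) = ((N(v) − 𝟙{v=h})/K)·acc(h,v)` off the diagonal, `m(h)·K_N(h,v) = m(v)·K_N(v,h)` for `h ≠ v`
(both equal `(N(h)N(v)/K)·min{1/W(h),1/W(v)}`). [ours] -/
theorem hubChain_detailedBalance (hW : ∀ v, 0 < W v) (hacc : ∀ h v, acc h v = min 1 (W h / W v)) (hm : ∀ v, m v = (N v : ℝ) / W v)
    (hKoff : ∀ h v, h ≠ v → Kh h v = ((N v : ℝ) - (if v = h then 1 else 0)) / K * acc h v) {h v : S} (hhv : h ≠ v) :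
    m h * Kh h v = m v * Kh v h := by
  rw [hKoff h v hhv, hKoff v h (Ne.symm hhv), if_neg (Ne.symm hhv), if_neg hhv, sub_zero, sub_zero, hm, hm]
  have e1 : (N h : ℝ) / W h * ((N v : ℝ) / K * acc h v) = (N h : ℝ) * (N v : ℝ) / K * (acc h v / W h) := by ring
  have e2 : (N v : ℝ) / W v * ((N h : ℝ) / K * acc v h) = (N h : ℝ) * (N v : ℝ) / K * (acc v h / W v) := by ring
  rw [e1, e2, hub_acc_mul_inv hW hacc, hub_acc_mul_inv hW hacc, min_comm]

omit [Fintype S] in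
/-- Off-diagonal entries are non-negative (`N(v) ≥ 𝟙{v = h}` is automatic off the diagonal). [ours] -/
theorem hubChain_offDiag_nonneg (hW : ∀ v, 0 < W v) (hacc : ∀ h v, acc h v = min 1 (W h / W v))
    (hKoff : ∀ h v, h ≠ v → Kh h v = ((N v : ℝ) - (if v = h then 1 else 0)) / K * acc h v) {h v : S} (hhv : h ≠ v) : 0 ≤ Kh h v := by
  rw [hKoff h v hhv, if_neg (Ne.symm hhv), sub_zero, hacc]
  exact mul_nonneg (div_nonneg (Nat.cast_nonneg _) (Nat.cast_nonneg _)) (le_min zero_le_one (div_nonneg (hW h).le (hW v).le))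

/-- The off-diagonal row mass is at most `1`: `Σ_{v ≠ h} K_N(h,v) ≤ Σ_{v≠h} N(v)/K ≤ 1` when `N(h) ≥ 1` and `Σ N = K + 1`. [ours] -/
theorem hubChain_offDiag_sum_le (hW : ∀ v, 0 < W v) (hacc : ∀ h v, acc h v = min 1 (W h / W v))
    (hKoff : ∀ h v, h ≠ v → Kh h v = ((N v : ℝ) - (if v = h then 1 else 0)) / K * acc h v) (hK : 1 ≤ K) (hsum : ∑ v, N v = K + 1)
    {h : S} (hNh : 1 ≤ N h) : ∑ v ∈ univ.erase h, Kh h v ≤ 1 := by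
  have hK0 : (0 : ℝ) < K := by exact_mod_cast hK
  calc ∑ v ∈ univ.erase h, Kh h v ≤ ∑ v ∈ univ.erase h, (N v : ℝ) / K := by
        refine sum_le_sum fun v hv => ?_
        have hvh : v ≠ h := ne_of_mem_erase hv
        rw [hKoff h v (Ne.symm hvh), if_neg hvh, sub_zero]
        have ha : acc h v ≤ 1 := by rw [hacc]; exact min_le_left _ _
        have ha0 : 0 ≤ acc h v := by rw [hacc]; exact le_min zero_le_one (div_nonneg (hW h).le (hW v).le)
        calc (N v : ℝ) / K * acc h v ≤ (N v : ℝ) / K * 1 := mul_le_mul_of_nonneg_left ha (div_nonneg (Nat.cast_nonneg _) hK0.le)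
          _ = (N v : ℝ) / K := mul_one _
    _ = ((∑ v, (N v : ℝ)) - N h) / K := by
        rw [← sum_div, ← Finset.sum_erase_add univ (fun v => (N v : ℝ)) (mem_univ h)]; ring
    _ = ((K + 1 : ℝ) - N h) / K := by
        congr 1; rw [← Nat.cast_sum, hsum]; push_cast; ring
    _ ≤ 1 := by
        rw [div_le_one hK0]
        have : (1 : ℝ) ≤ N h := by exact_mod_cast hNh
        linarith

/-- **STATIONARITY OF `m = N/W` FOR THE SWAP PHASE:** with the diagonal completing the rows (`K_N(h,h) = 1 − Σ_{v≠h} K_N(h,v)`), `Σ_h m(h)K_N(h,v) = m(v)` for every `v`. [ours] -/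
theorem hubChain_stationary (hW : ∀ v, 0 < W v) (hacc : ∀ h v, acc h v = min 1 (W h / W v)) (hm : ∀ v, m v = (N v : ℝ) / W v)
    (hKoff : ∀ h v, h ≠ v → Kh h v = ((N v : ℝ) - (if v = h then 1 else 0)) / K * acc h v)
    (hKdiag : ∀ h, Kh h h = 1 - ∑ v ∈ univ.erase h, Kh h v) (v : S) :
    ∑ h, m h * Kh h v = m v := by
  rw [← Finset.sum_erase_add univ (fun h => m h * Kh h v) (mem_univ v), hKdiag, mul_sub, mul_one]
  have hdb : ∑ h ∈ univ.erase v, m h * Kh h v = ∑ h ∈ univ.erase v, m v * Kh v h := by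
    refine sum_congr rfl fun h hh => ?_
    exact hubChain_detailedBalance hW hacc hm hKoff (ne_of_mem_erase hh)
  rw [hdb, ← Finset.mul_sum]
  ring

/-- **The urn law `u = (N/W)/Z` is stationary for the swap phase** (`Z > 0`). [ours] -/
theorem hubChain_urnLaw_stationary (hW : ∀ v, 0 < W v) (hacc : ∀ h v, acc h v = min 1 (W h / W v)) {Z : ℝ} {u : S → ℝ}
    (hu : ∀ v, u v = (N v : ℝ) / W v / Z)
    (hKoff : ∀ h v, h ≠ v → Kh h v = ((N v : ℝ) - (if v = h then 1 else 0)) / K * acc h v)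
    (hKdiag : ∀ h, Kh h h = 1 - ∑ v ∈ univ.erase h, Kh h v) (v : S) :
    ∑ h, u h * Kh h v = u v := by
  have h := hubChain_stationary (m := fun v => (N v : ℝ) / W v) hW hacc (fun _ => rfl) hKoff hKdiag v
  have hu' : ∀ w, u w = (N w : ℝ) / W w * (1 / Z) := fun w => by rw [hu]; ring
  simp_rw [hu', mul_assoc, mul_comm (1 / Z), ← mul_assoc, ← Finset.sum_mul, h]

end HubChain

end Summit.Ventures.LatticeQCDFlow.Scaling
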